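import Summits.QuantumFields.BalabanUV.T4Continuum.Support.NE3SmoothLiftBounds
import Summits.QuantumFields.BalabanUV.T4Continuum.Support.NE3SpreadLiftCurl
import HarnessLib

/-!
# T⁴ programme, node NE3 — route Π, row Π-R («SMOOTH RIGHT INVERSE», D-ne3p1-g24-1 §6), file Π-R♭-4b: THE CURL LETTERS OF THE SMOOTH LIFT AT
# THE FLAT BACKGROUND — `curlSq ≤ 4d·(24·8^{d−1})²·M^{d−4}·‖φ‖²` and `curlL1 ≤ 2d·24·8^{d−1}·M^{d−2}·‖φ‖_ℓ¹`, NO `∇φ`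

NE3 (node U1b) formalisation swarm, leaf seat `b2b-balaban-t4-ne3-formalise-leaf-01` (gen 7); owner GO ρ-g24-3 (4) (`HOME/CLAIMS.log` l.21552).  WHY NO
`∇φ`: the lift `smoothLift M φ` (Π-R♭-2) VANISHES ON EVERY BLOCK FACE (Π-R♭-4a `smoothLift_of_res_self_eq_zero` ∕ `_of_res_ne_eq_zero`), so the data of
two neighbouring blocks never meet in a plaquette; inside a block a transverse unit step moves only one factor `fac_α` of the transverse bump, by
`≤ 1∕M` (K5a `abs_fac_step_le`), against `|lprof| ≤ M` and `liftNorm ≥ M²∕(24·8^{d−1})`: every transverse increment of the κ-component is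
`≤ (24·8^{d−1}∕M²)·‖φ(blk, κ)‖`, and the flat curl of a plaquette `(μ, ν)` is the difference of two transverse increments.  The corrector of Π-R♭-3 is a
coboundary (zero flat curl), so these ARE the curl letters of `smoothRightInverse` at `W = 1` (Π-R♭-4c states that with the corrector's ℓ²∕sup).

CONTENT ([folklore]; 0 sorry; 0 def), `M ≥ 2`, `d ≥ 1`, `C := 24·8^{d−1}`: §1 `curlAt_flat_eq` (the flat curl is `Δ_μY_ν − Δ_νY_μ`), `tperp_split`;
§2 **`norm_smoothLift_step_le`** (`α ≠ κ`: `‖A(x+e_α, κ) − A(x, κ)‖ ≤ (C∕M²)·‖φ(blk M x, κ)‖`); §3 **`norm_curlAt_flat_smoothLift_le`** (`μ ≠ ν`: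
`≤ (C∕M²)·(‖φ(blk x, ν)‖ + ‖φ(blk x, μ)‖)`); §4 **`curlSq_flat_smoothLift_le`**: `curlSq 1 (smoothLift M φ) (periodBox (M·N)) ≤ 4d·C²·(M^d∕M⁴)·Σ_{z∈periodBox N}Σ_κ ‖φ z κ‖²`
and **`curlL1_flat_smoothLift_le`**: `curlL1 1 (smoothLift M φ) (periodBox (M·N)) ≤ 2d·C·(M^d∕M²)·Σ_zΣ_κ ‖φ z κ‖` — at d = 4: `4d·C² = 2.4e9`, `2d·C = 98 304`
(crude by the profile's true ratio ≈ (70·1.5^{d−1}∕12 288)² ≈ 4e-4; honest, k-FREE).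

HONEST FRAMING.  Flat kinematics of OUR lift; SHAPE `SmoothLift` NOT yet discharged (corrector letters Π-R♭-4c, curved W Π-R-W); (P♮)_W, T-E_w and **NE3
are NOT proved**; spine PROVED 0∕9; finite T⁴ rung (B)+1 — NOT infinite volume, NOT mass gap, NOT `BetaPertH`, NOT Clay.  PLACEMENT:
`Summits/QuantumFields/BalabanUV/`.  HONEST DEPENDENCY (cell page 1): continuum YM on T⁴ ⇐ BetaPertH ∧ nine spine estimates (0/9 proved); BetaPertH ⇐ (D1) ∧
(D4) ∧ CAP+tail; G-an2-4 gates asym, D1 and NE2/3/4.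
-/

set_option autoImplicit false

open scoped BigOperators Matrix.Norms.L2Operator
open Finset

namespace Summit.QuantumFields.BalabanUV.T4Continuum.NE3SmoothLiftCurl

open Literature.MathematicalPhysics.QuantumFieldTheory.Balaban1983to89
open B7Prop1Explicit B7Prop2Explicit
open T4AveragingDeficitWall (curlAt curl curlSq curlL1 Ad)
open T4AveragingDeficitWallBoundary (periodBox mem_periodBox card_periodBox)
open BlockAveragePushDirSplit (flat)
open SmoothRefineBlocks (blk res res_nonneg res_lt blk_add_e res_add_e_self res_add_e_ne)
open NE3CoarseInterpolant (blk_block)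
open NE3BlockLineAverage (sum_periodBox_blocks)
open NE3TentBump (fac fac_nonneg fac_le_one fac_le_inv_of_res_eq abs_fac_step_le)
open NE3TentBumpSharp (fac_add_e_ne)
open NE3SpreadLiftCurl (sum_plane_pair_le)
open NE3SmoothLiftProfile (lprof abs_lprof_le)
open NE3SmoothLiftFlat (tperp liftNorm smoothLift liftNorm_pos)
open NE3SmoothLiftBounds (liftNorm_ge tperp_nonneg tperp_le_one smoothLift_of_res_ne_eq_zero)

noncomputable section

variable {d : ℕ} {n : Type*} [Fintype n] [DecidableEq n]

/-! ## §1 The flat curl; splitting one factor off the transverse bump -/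

/-- The dressed curl at the flat background is the lattice curl: `curlAt 1 Y x μ ν = (Y(x+e_μ) ν − Y x ν) − (Y(x+e_ν) μ − Y x μ)`. [folklore] -/
theorem curlAt_flat_eq (Y : Site d → Fin d → Matrix n n ℂ) (x : Site d) (μ ν : Fin d) :
    curlAt (flat (d := d) (n := n)) Y x μ ν = (Y (x + e μ) ν - Y x ν) - (Y (x + e ν) μ - Y x μ) := by
  simp only [curlAt, BlockAveragePushDirSplit.flat, mul_one, inv_one, Ad, Units.val_one, one_mul]
  abel

omit [Fintype n] [DecidableEq n] in
/-- One factor split off the transverse bump: `tperp M κ y = fac M y α · Π_{j ∉ {κ, α}} fac M y j` (`α ≠ κ`). [folklore] -/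
theorem tperp_split (M : ℕ) {κ α : Fin d} (hne : α ≠ κ) (y : Site d) :
    tperp M κ y = fac M y α * ∏ j ∈ (Finset.univ.erase κ).erase α, fac M y j := by
  unfold tperp
  rw [← Finset.mul_prod_erase _ _ (Finset.mem_erase.mpr ⟨hne, Finset.mem_univ α⟩)]

/-! ## §2 Transverse increments of the lift -/

/-- **A TRANSVERSE UNIT STEP MOVES THE LIFT BY `O(φ∕M²)`** (`M ≥ 2`, `d ≥ 1`, `α ≠ κ`):
`‖smoothLift M φ (x + e α) κ − smoothLift M φ x κ‖ ≤ (24·8^{d−1}∕M²)·‖φ (blk M x) κ‖` — inside the block only `fac_α` moves (by `≤ 1∕M`);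
across the transverse face the arriving lift is `0` and the departing one carries `fac_α ≤ 1∕M`. [folklore] -/
theorem norm_smoothLift_step_le {M : ℕ} (hM : 2 ≤ M) (hd : 1 ≤ d) (φ : Site d → Fin d → Matrix n n ℂ) (x : Site d) {α κ : Fin d}
    (hne : α ≠ κ) :
    ‖smoothLift M φ (x + e α) κ - smoothLift M φ x κ‖ ≤ (24 * (8 : ℝ) ^ (d - 1) / (M : ℝ) ^ 2) * ‖φ (blk M x) κ‖ := by
  have hM1 : 1 ≤ M := by omega
  have hM0 : (0 : ℝ) < M := by exact_mod_cast (by omega : 0 < M)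
  have hc := liftNorm_pos hM d
  have hcge := liftNorm_ge hM d hd
  have hg : |lprof M (res M x κ)| ≤ M := abs_lprof_le hM1 (res_nonneg hM1 x κ) (res_lt hM1 x κ).le
  -- the common final step: `c⁻¹ · M · (1/M) ≤ 24·8^{d−1}/M²`
  have hkey : (liftNorm d M)⁻¹ * ((M : ℝ) * (1 / M)) ≤ 24 * (8 : ℝ) ^ (d - 1) / (M : ℝ) ^ 2 := by
    rw [mul_one_div_cancel hM0.ne', mul_one, inv_le_comm₀ hc (by positivity), inv_div]
    exact hcge
  -- the product of the untouched factors is in `[0,1]`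
  have hP0 : ∀ y : Site d, 0 ≤ ∏ j ∈ (Finset.univ.erase κ).erase α, fac M y j := fun y => Finset.prod_nonneg fun j _ => fac_nonneg hM1 y j
  have hP1 : ∀ y : Site d, ∏ j ∈ (Finset.univ.erase κ).erase α, fac M y j ≤ 1 :=
    fun y => Finset.prod_le_one (fun j _ => fac_nonneg hM1 y j) fun j _ => fac_le_one hM1 y j
  by_cases hface : res M x α = (M : ℤ) - 1
  · -- across the face: the lift at `x + e α` vanishes
    have hr0 : res M (x + e α) α = 0 := by rw [res_add_e_self hM1, if_pos hface]
    rw [smoothLift_of_res_ne_eq_zero M φ hne hr0, zero_sub, norm_neg]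
    unfold smoothLift
    rw [norm_smul, Real.norm_eq_abs, abs_mul, abs_mul, abs_of_pos (inv_pos.mpr hc), tperp_split M hne,
      abs_of_nonneg (mul_nonneg (fac_nonneg hM1 x α) (hP0 x))]
    refine mul_le_mul_of_nonneg_right ?_ (norm_nonneg _)
    have hfa : fac M x α * ∏ j ∈ (Finset.univ.erase κ).erase α, fac M x j ≤ 1 / M :=
      (mul_le_mul (fac_le_inv_of_res_eq hM1 hface) (hP1 x) (hP0 x) (by positivity)).trans (le_of_eq (mul_one _))
    calc (liftNorm d M)⁻¹ * (|lprof M (res M x κ)| * (fac M x α * ∏ j ∈ (Finset.univ.erase κ).erase α, fac M x j))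
        ≤ (liftNorm d M)⁻¹ * ((M : ℝ) * (1 / M)) :=
          mul_le_mul_of_nonneg_left (mul_le_mul hg hfa (mul_nonneg (fac_nonneg hM1 x α) (hP0 x)) hM0.le) (inv_nonneg.mpr hc.le)
      _ ≤ _ := hkey
  · -- inside the block: same block, same `res_κ`, only `fac_α` moves
    have hblk : blk M (x + e α) = blk M x := by rw [blk_add_e hM1, if_neg hface, add_zero]
    have hresκ : res M (x + e α) κ = res M x κ := res_add_e_ne hM1 x hne.symm
    have hprod : ∏ j ∈ (Finset.univ.erase κ).erase α, fac M (x + e α) j = ∏ j ∈ (Finset.univ.erase κ).erase α, fac M x j :=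
      Finset.prod_congr rfl fun j hj => fac_add_e_ne hM1 x (Finset.ne_of_mem_erase hj)
    unfold smoothLift
    rw [hblk, hresκ, tperp_split M hne, tperp_split M hne, hprod, ← sub_smul, norm_smul, Real.norm_eq_abs]
    refine mul_le_mul_of_nonneg_right ?_ (norm_nonneg _)
    have hid : (liftNorm d M)⁻¹ * (lprof M (res M x κ) * (fac M (x + e α) α * ∏ j ∈ (Finset.univ.erase κ).erase α, fac M x j))
        - (liftNorm d M)⁻¹ * (lprof M (res M x κ) * (fac M x α * ∏ j ∈ (Finset.univ.erase κ).erase α, fac M x j))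
        = (liftNorm d M)⁻¹ * (lprof M (res M x κ) * ((fac M (x + e α) α - fac M x α) * ∏ j ∈ (Finset.univ.erase κ).erase α, fac M x j)) := by
      ring
    rw [hid, abs_mul, abs_mul, abs_mul, abs_of_pos (inv_pos.mpr hc), abs_of_nonneg (hP0 x)]
    have hstep := abs_fac_step_le hM1 hface
    calc (liftNorm d M)⁻¹ * (|lprof M (res M x κ)| * (|fac M (x + e α) α - fac M x α| * ∏ j ∈ (Finset.univ.erase κ).erase α, fac M x j))
        ≤ (liftNorm d M)⁻¹ * ((M : ℝ) * (1 / M)) := by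
          refine mul_le_mul_of_nonneg_left (mul_le_mul hg ?_ (mul_nonneg (abs_nonneg _) (hP0 x)) hM0.le) (inv_nonneg.mpr hc.le)
          exact (mul_le_mul hstep (hP1 x) (hP0 x) (by positivity)).trans (le_of_eq (mul_one _))
      _ ≤ _ := hkey

/-! ## §3 The flat curl of the lift, plaquette by plaquette -/

/-- **THE FLAT CURL OF THE LIFT IS `O(φ∕M²)` ON EVERY PLAQUETTE** (`μ ≠ ν`):
`‖curlAt 1 (smoothLift M φ) x μ ν‖ ≤ (24·8^{d−1}∕M²)·(‖φ(blk x, ν)‖ + ‖φ(blk x, μ)‖)`. [folklore] -/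
theorem norm_curlAt_flat_smoothLift_le {M : ℕ} (hM : 2 ≤ M) (hd : 1 ≤ d) (φ : Site d → Fin d → Matrix n n ℂ) (x : Site d) {μ ν : Fin d}
    (hμν : μ ≠ ν) :
    ‖curlAt (flat (d := d) (n := n)) (smoothLift M φ) x μ ν‖
      ≤ (24 * (8 : ℝ) ^ (d - 1) / (M : ℝ) ^ 2) * (‖φ (blk M x) ν‖ + ‖φ (blk M x) μ‖) := by
  rw [curlAt_flat_eq, mul_add]
  exact (norm_sub_le _ _).trans (add_le_add (norm_smoothLift_step_le hM hd φ x hμν) (norm_smoothLift_step_le hM hd φ x (Ne.symm hμν)))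

/-! ## §4 The two curl letters -/

/-- **THE `curlSq` LETTER**: `curlSq 1 (smoothLift M φ) (periodBox (M·N)) ≤ 4d·(24·8^{d−1})²·(M^d∕M⁴)·Σ_{z∈periodBox N}Σ_κ ‖φ z κ‖²` — NO `∇φ`. [folklore] -/
theorem curlSq_flat_smoothLift_le {M : ℕ} (hM : 2 ≤ M) (hd : 1 ≤ d) (N : ℕ) (φ : Site d → Fin d → Matrix n n ℂ) :
    curlSq (flat (d := d) (n := n)) (smoothLift M φ) (periodBox (d := d) (M * N))
      ≤ 4 * (d : ℝ) * (24 * (8 : ℝ) ^ (d - 1)) ^ 2 * ((M : ℝ) ^ d / (M : ℝ) ^ 4) * ∑ z ∈ periodBox (d := d) N, ∑ κ : Fin d, ‖φ z κ‖ ^ 2 := by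
  have hM1 : 1 ≤ M := by omega
  have hM0 : (0 : ℝ) < M := by exact_mod_cast (by omega : 0 < M)
  set C : ℝ := 24 * (8 : ℝ) ^ (d - 1) / (M : ℝ) ^ 2 with hC
  have hC0 : 0 ≤ C := by positivity
  -- one site: sum over planes
  have hsite : ∀ x : Site d, ∑ π : T4AveragingDeficitWall.Plane d, ‖curl (flat (d := d) (n := n)) (smoothLift M φ) (x, π)‖ ^ 2
      ≤ 2 * C ^ 2 * (2 * d * ∑ κ : Fin d, ‖φ (blk M x) κ‖ ^ 2) := by
    intro x
    have hpl : ∀ π : T4AveragingDeficitWall.Plane d, ‖curl (flat (d := d) (n := n)) (smoothLift M φ) (x, π)‖ ^ 2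
        ≤ 2 * C ^ 2 * (‖φ (blk M x) π.1.1‖ ^ 2 + ‖φ (blk M x) π.1.2‖ ^ 2) := by
      intro π
      have hne : π.1.1 ≠ π.1.2 := ne_of_lt π.2
      have h := norm_curlAt_flat_smoothLift_le hM hd φ x hne
      have h0 : 0 ≤ ‖φ (blk M x) π.1.2‖ + ‖φ (blk M x) π.1.1‖ := by positivity
      calc ‖curl (flat (d := d) (n := n)) (smoothLift M φ) (x, π)‖ ^ 2
          ≤ (C * (‖φ (blk M x) π.1.2‖ + ‖φ (blk M x) π.1.1‖)) ^ 2 := pow_le_pow_left₀ (norm_nonneg _) h 2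
        _ ≤ _ := by
            rw [mul_pow]
            nlinarith [sq_nonneg (‖φ (blk M x) π.1.2‖ - ‖φ (blk M x) π.1.1‖), sq_nonneg C]
    calc ∑ π : T4AveragingDeficitWall.Plane d, ‖curl (flat (d := d) (n := n)) (smoothLift M φ) (x, π)‖ ^ 2
        ≤ ∑ π : T4AveragingDeficitWall.Plane d, 2 * C ^ 2 * (‖φ (blk M x) π.1.1‖ ^ 2 + ‖φ (blk M x) π.1.2‖ ^ 2) :=
          Finset.sum_le_sum fun π _ => hpl π
      _ = 2 * C ^ 2 * ∑ π : T4AveragingDeficitWall.Plane d, (‖φ (blk M x) π.1.1‖ ^ 2 + ‖φ (blk M x) π.1.2‖ ^ 2) := by rw [Finset.mul_sum]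
      _ ≤ 2 * C ^ 2 * (2 * d * ∑ κ : Fin d, ‖φ (blk M x) κ‖ ^ 2) :=
          mul_le_mul_of_nonneg_left (sum_plane_pair_le (h := fun κ => ‖φ (blk M x) κ‖ ^ 2) fun κ => sq_nonneg _) (by positivity)
  unfold curlSq
  calc ∑ x ∈ periodBox (d := d) (M * N), ∑ π : T4AveragingDeficitWall.Plane d, ‖curl (flat (d := d) (n := n)) (smoothLift M φ) (x, π)‖ ^ 2
      ≤ ∑ x ∈ periodBox (d := d) (M * N), 2 * C ^ 2 * (2 * d * ∑ κ : Fin d, ‖φ (blk M x) κ‖ ^ 2) := Finset.sum_le_sum fun x _ => hsite x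
    _ = (M : ℝ) ^ d * ∑ z ∈ periodBox (d := d) N, 2 * C ^ 2 * (2 * d * ∑ κ : Fin d, ‖φ z κ‖ ^ 2) := by
        rw [← sum_periodBox_blocks M N hM1, Finset.mul_sum]
        refine Finset.sum_congr rfl fun z _ => ?_
        rw [Finset.sum_congr rfl fun v hv => by rw [blk_block hM1 z hv], Finset.sum_const, card_periodBox, nsmul_eq_mul, Nat.cast_pow]
    _ = 4 * (d : ℝ) * (24 * (8 : ℝ) ^ (d - 1)) ^ 2 * ((M : ℝ) ^ d / (M : ℝ) ^ 4) * ∑ z ∈ periodBox (d := d) N, ∑ κ : Fin d, ‖φ z κ‖ ^ 2 := by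
        rw [← Finset.mul_sum, ← Finset.mul_sum, hC]
        field_simp
        ring

/-- **THE `curlL1` LETTER**: `curlL1 1 (smoothLift M φ) (periodBox (M·N)) ≤ 2d·(24·8^{d−1})·(M^d∕M²)·Σ_{z∈periodBox N}Σ_κ ‖φ z κ‖`. [folklore] -/
theorem curlL1_flat_smoothLift_le {M : ℕ} (hM : 2 ≤ M) (hd : 1 ≤ d) (N : ℕ) (φ : Site d → Fin d → Matrix n n ℂ) :
    curlL1 (flat (d := d) (n := n)) (smoothLift M φ) (periodBox (d := d) (M * N))
      ≤ 2 * (d : ℝ) * (24 * (8 : ℝ) ^ (d - 1)) * ((M : ℝ) ^ d / (M : ℝ) ^ 2) * ∑ z ∈ periodBox (d := d) N, ∑ κ : Fin d, ‖φ z κ‖ := by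
  have hM1 : 1 ≤ M := by omega
  have hM0 : (0 : ℝ) < M := by exact_mod_cast (by omega : 0 < M)
  set C : ℝ := 24 * (8 : ℝ) ^ (d - 1) / (M : ℝ) ^ 2 with hC
  have hC0 : 0 ≤ C := by positivity
  have hsite : ∀ x : Site d, ∑ π : T4AveragingDeficitWall.Plane d, ‖curl (flat (d := d) (n := n)) (smoothLift M φ) (x, π)‖
      ≤ C * (2 * d * ∑ κ : Fin d, ‖φ (blk M x) κ‖) := by
    intro x
    calc ∑ π : T4AveragingDeficitWall.Plane d, ‖curl (flat (d := d) (n := n)) (smoothLift M φ) (x, π)‖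
        ≤ ∑ π : T4AveragingDeficitWall.Plane d, C * (‖φ (blk M x) π.1.1‖ + ‖φ (blk M x) π.1.2‖) :=
          Finset.sum_le_sum fun π _ => by
            have h := norm_curlAt_flat_smoothLift_le hM hd φ x (ne_of_lt π.2)
            rw [add_comm] at h; exact h
      _ = C * ∑ π : T4AveragingDeficitWall.Plane d, (‖φ (blk M x) π.1.1‖ + ‖φ (blk M x) π.1.2‖) := by rw [Finset.mul_sum]
      _ ≤ C * (2 * d * ∑ κ : Fin d, ‖φ (blk M x) κ‖) :=
          mul_le_mul_of_nonneg_left (sum_plane_pair_le (h := fun κ => ‖φ (blk M x) κ‖) fun κ => norm_nonneg _) hC0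
  unfold curlL1
  calc ∑ x ∈ periodBox (d := d) (M * N), ∑ π : T4AveragingDeficitWall.Plane d, ‖curl (flat (d := d) (n := n)) (smoothLift M φ) (x, π)‖
      ≤ ∑ x ∈ periodBox (d := d) (M * N), C * (2 * d * ∑ κ : Fin d, ‖φ (blk M x) κ‖) := Finset.sum_le_sum fun x _ => hsite x
    _ = (M : ℝ) ^ d * ∑ z ∈ periodBox (d := d) N, C * (2 * d * ∑ κ : Fin d, ‖φ z κ‖) := by
        rw [← sum_periodBox_blocks M N hM1, Finset.mul_sum]
        refine Finset.sum_congr rfl fun z _ => ?_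
        rw [Finset.sum_congr rfl fun v hv => by rw [blk_block hM1 z hv], Finset.sum_const, card_periodBox, nsmul_eq_mul, Nat.cast_pow]
    _ = _ := by
        rw [← Finset.mul_sum, ← Finset.mul_sum, hC]
        field_simp

end

end Summit.QuantumFields.BalabanUV.T4Continuum.NE3SmoothLiftCurl
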